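import Summits.BirchSwinnertonDyer.BirchSwinnertonDyer.Theorems.GenusKolyvaginAtTwoMinimalTwinBSDTwoSwappedPairOneBitPrime
import Summits.BirchSwinnertonDyer.BirchSwinnertonDyer.Theorems.GenusKolyvaginAtTwoMinimalTwinBSDTwoSwappedPairBudgetParity
import HarnessLib

/-!
# Route `GenusKolyvaginAtTwo`, crux U₂ `MinimalTwinBSDTwo` (stmt-BirchSwinnertonDyer-22985): THE PRIME HEEGNER FRAME `K = ℚ(√−ℓ)` —
# the ramified prime `ℓ` sees exactly ONE root of the 2-division cubic on `Δ < 0`, and ZERO OR THREE roots on `Δ > 0`; so the reversed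
# supplies' Tamagawa clauses read «`ℓ` not of identity type» (UNCONDITIONAL reduction-type bookkeeping)

Seat `bsd-line-gk2-p3` g28 (PROVER seat 3/3, cell `bsd-f1-sign2`), `--supports stmt-BirchSwinnertonDyer-22985` (helper; closes nothing).
THEOREMS ONLY (no definition, no named fact, no `sorry`); standard axioms; everything UNCONDITIONAL.  **BSD is NOT proved by this file;
nothing is closed.**

For a globally minimal `W/ℚ` and an imaginary quadratic `K` with `d_K = −ℓ` (`ℓ` prime), `d_K` odd, Heegner for `N_W`, and any elliptic
`ℚ`-model `Wd` of `W^(d_K)`, the tree's twin Tamagawa law (`padicValNat_two_tamagawaProduct_twin_eq`, hT-free form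
`OneBit.prod_ncard_roots_add_one_mul_eq_two_pow_padicValNat_tamagawaProduct_twin`, p766610) reads, with `n_ℓ := #{x ∈ 𝔽_ℓ : 4x³ + b₂x² + 2b₄x +
b₆ = 0}` the number of roots of the `2`-division cubic of the minimal model mod `ℓ`:  **`(n_ℓ + 1) · 2^{ord₂ C(W)} = 2^{ord₂ C(Wd)}`** (§1).  Since a
cubic over the field `𝔽_ℓ` (`ℓ` odd) has at most `3` roots (§0) and the hT-free parity law (`BudgetParity.neg_one_pow_…_eq_mul_sign`, p767705:
`ord₂ C(Wd) ≡ ord₂ C(W) + [Δ_W < 0] (mod 2)`) fixes the parity: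

* §2 (`Δ_W < 0`) **`ncard_roots_eq_one_of_discr_eq_neg_prime_of_Δ_neg`**: `n_ℓ = 1` — `ℓ` is ALWAYS of transposition type (restates p767140's
  `ord₂ C(Wd) = ord₂ C(W) + 1` on the root side).
* §3 (`0 < Δ_W`) **`ncard_roots_eq_zero_or_eq_three_of_discr_eq_neg_prime_of_Δ_pos`**: `n_ℓ ∈ {0, 3}` and
  **`padicValNat_twin_eq_or_eq_add_two_of_discr_eq_neg_prime_of_Δ_pos`**: `ord₂ C(Wd) ∈ {ord₂ C(W), ord₂ C(W) + 2}` — `ℓ` is either SILENT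
  (`3`-cycle type, cubic irreducible mod `ℓ`) or of IDENTITY type (totally split, two Tamagawa bits); and the dictionary
  **`padicValNat_twin_eq_iff_forall_ne_zero`** (any sign): `ord₂ C(Wd) = ord₂ C(W)` ⟺ the cubic has NO root mod `ℓ`,
  **`padicValNat_twin_eq_add_two_iff_exists_eq_zero_of_Δ_pos`**: `ord₂ C(Wd) = ord₂ C(W) + 2` ⟺ the cubic HAS a root mod `ℓ`.

READING (planner currency).  The prime-frame reversed supplies of this seat's ledger (`…RouteLedgerLine25Prime`: S2″′ on `hTw0 = (Δ>0, ord₂C=0)`,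
S2⁼′ on `hTw2`, S2⁻′ on `hTw1`) carry NO Tamagawa clause: on `Δ < 0` nothing is asked (§2), on `Δ > 0` the clause «cubic rootless mod `ℓ`» is
EXACTLY «`ℓ` not of identity type» ⟺ «the twist is silent» ⟺ «`ord₂ C(Wd) ≠ ord₂ C(W) + 2`» (§3); the complementary identity-type primes put the
twin two Tamagawa bits up — the `K₄⁺`/X⁼²-type cells of the `Δ > 0` lanes (gk2-p5, gk2-p4), not a U₂ cell consumed by `closes` (rev 57).

References: [Kramer1981] §2 Prop. 3; [SilvermanAEC2009] III.1, VII.6 (Tate's algorithm, `c_ℓ` of additive type I₀*); [GrossLMS1991] §3 (3.3);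
[Miller2011LMS] Def. 1.1.
-/

set_option autoImplicit false
set_option linter.dupNamespace false -- `Summit.<P>.<Sub>` repeats `BirchSwinnertonDyer` (D-0017)

noncomputable section

open scoped Classical

open WeierstrassCurve NumberField Literature.NumberTheory.EllipticCurves
  Summit.BirchSwinnertonDyer.BirchSwinnertonDyer.Theorems.GenusExact.TwinSwap.OneBit
  Summit.BirchSwinnertonDyer.BirchSwinnertonDyer.Theorems.GenusExact.PlusDescent.BudgetParity

namespace Summit.BirchSwinnertonDyer.BirchSwinnertonDyer.Theorems.GenusExact.TwinSwap.PrimeFrame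

/-! ## §0 A cubic over `𝔽_ℓ` (`ℓ` an odd prime) has at most three roots -/

/-- Over `ZMod ℓ`, `ℓ` a prime `≠ 2`, the set of roots of `4x³ + ax² + bx + c` has at most `3` elements (the polynomial is non-zero of degree
`≤ 3`).  [cite: SilvermanAEC2009, III.1] -/
theorem ncard_cubicRoots_le_three {ℓ : ℕ} [Fact ℓ.Prime] (hℓ2 : ℓ ≠ 2) (a b c : ZMod ℓ) :
    {x : ZMod ℓ | 4 * x ^ 3 + a * x ^ 2 + b * x + c = 0}.ncard ≤ 3 := by
  have h2 : (2 : ZMod ℓ) ≠ 0 := by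
    intro h
    have hdvd : ℓ ∣ 2 := (ZMod.natCast_eq_zero_iff 2 ℓ).mp (by exact_mod_cast h)
    have hle : ℓ ≤ 2 := Nat.le_of_dvd two_pos hdvd
    have h2le : 2 ≤ ℓ := (Fact.out : ℓ.Prime).two_le
    omega
  have h4 : (4 : ZMod ℓ) ≠ 0 := by
    rw [show (4 : ZMod ℓ) = 2 * 2 by norm_num]
    exact mul_ne_zero h2 h2
  have hp0 : Polynomial.C 4 * Polynomial.X ^ 3 + Polynomial.C a * Polynomial.X ^ 2 + Polynomial.C b * Polynomial.X + Polynomial.C c ≠ 0 := by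
    intro h0
    apply h4
    have hl := Polynomial.leadingCoeff_cubic (b := a) (c := b) (d := c) h4
    rw [h0, Polynomial.leadingCoeff_zero] at hl
    exact hl.symm
  have hset : {x : ZMod ℓ | 4 * x ^ 3 + a * x ^ 2 + b * x + c = 0} =
      ↑(Polynomial.C 4 * Polynomial.X ^ 3 + Polynomial.C a * Polynomial.X ^ 2 + Polynomial.C b * Polynomial.X +
        Polynomial.C c).roots.toFinset := by
    ext x
    rw [Finset.mem_coe, Multiset.mem_toFinset, Polynomial.mem_roots hp0, Polynomial.IsRoot.def]
    simp only [Polynomial.eval_add, Polynomial.eval_mul, Polynomial.eval_C, Polynomial.eval_pow, Polynomial.eval_X, Set.mem_setOf_eq]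
  rw [hset, Set.ncard_coe_finset]
  exact (Multiset.toFinset_card_le _).trans ((Polynomial.card_roots' _).trans Polynomial.natDegree_cubic_le)

section Frame

variable (W : WeierstrassCurve ℚ) [W.IsElliptic] [W.IsGloballyMinimal]
  {K : Type} [Field K] [NumberField K]

/-! ## §1 The one-prime budget identity -/

/-- **`(n_ℓ + 1) · 2^{ord₂ C(W)} = 2^{ord₂ C(Wd)}`** on the prime Heegner frame `d_K = −ℓ`: the hT-free twin Tamagawa law with a single ramified
prime.  UNCONDITIONAL.  [cite: Kramer1981, §2 Prop. 3] [cite: SilvermanAEC2009, VII.6] -/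
theorem ncard_roots_add_one_mul_eq_of_discr_eq_neg_prime (hK : IsImaginaryQuadratic K) (hodd : Odd (NumberField.discr K))
    (hH : SatisfiesHeegnerHypothesis (W.conductorNorm ℤ) K) {ℓ : ℕ} (hℓ : ℓ.Prime) (hd : NumberField.discr K = -(ℓ : ℤ))
    {Wd : WeierstrassCurve ℚ} [Wd.IsElliptic] (Cd : VariableChange ℚ) (hWd : Cd • W.quadraticTwist (NumberField.discr K : ℚ) = Wd) :
    ({x : ZMod ℓ | 4 * x ^ 3 + ((integralModelInt W).b₂ : ZMod ℓ) * x ^ 2 +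
        2 * ((integralModelInt W).b₄ : ZMod ℓ) * x + ((integralModelInt W).b₆ : ZMod ℓ) = 0}.ncard + 1) *
        2 ^ padicValNat 2 W.tamagawaProduct = 2 ^ padicValNat 2 Wd.tamagawaProduct := by
  have h := prod_ncard_roots_add_one_mul_eq_two_pow_padicValNat_tamagawaProduct_twin W hK hodd hH Cd hWd
  have hnat : (NumberField.discr K).natAbs = ℓ := by rw [hd, Int.natAbs_neg, Int.natAbs_natCast]
  rwa [hnat, Nat.Prime.primeFactors hℓ, Finset.prod_singleton] at h

/-- The ramified prime of a prime odd discriminant is odd. -/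
theorem prime_ne_two_of_discr_eq_neg_prime (hodd : Odd (NumberField.discr K)) {ℓ : ℕ} (hd : NumberField.discr K = -(ℓ : ℤ)) : ℓ ≠ 2 := by
  rintro rfl
  rw [hd] at hodd
  exact (Int.not_odd_iff_even.mpr (by decide : Even (-(2 : ℕ) : ℤ))) hodd

/-- **`n_ℓ ≤ 3`, hence `ord₂ C(W) ≤ ord₂ C(Wd) ≤ ord₂ C(W) + 2`** on the prime frame (any sign of `Δ`).  UNCONDITIONAL.
[cite: Kramer1981, §2 Prop. 3] -/
theorem padicValNat_le_and_le_add_two_of_discr_eq_neg_prime (hK : IsImaginaryQuadratic K) (hodd : Odd (NumberField.discr K))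
    (hH : SatisfiesHeegnerHypothesis (W.conductorNorm ℤ) K) {ℓ : ℕ} (hℓ : ℓ.Prime) (hd : NumberField.discr K = -(ℓ : ℤ))
    {Wd : WeierstrassCurve ℚ} [Wd.IsElliptic] (Cd : VariableChange ℚ) (hWd : Cd • W.quadraticTwist (NumberField.discr K : ℚ) = Wd) :
    padicValNat 2 W.tamagawaProduct ≤ padicValNat 2 Wd.tamagawaProduct ∧
      padicValNat 2 Wd.tamagawaProduct ≤ padicValNat 2 W.tamagawaProduct + 2 := by
  haveI := Fact.mk hℓ
  have h := ncard_roots_add_one_mul_eq_of_discr_eq_neg_prime W hK hodd hH hℓ hd Cd hWd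
  have hn := ncard_cubicRoots_le_three (prime_ne_two_of_discr_eq_neg_prime hodd hd) ((integralModelInt W).b₂ : ZMod ℓ)
    (2 * ((integralModelInt W).b₄ : ZMod ℓ)) ((integralModelInt W).b₆ : ZMod ℓ)
  set n := {x : ZMod ℓ | 4 * x ^ 3 + ((integralModelInt W).b₂ : ZMod ℓ) * x ^ 2 +
        2 * ((integralModelInt W).b₄ : ZMod ℓ) * x + ((integralModelInt W).b₆ : ZMod ℓ) = 0}.ncard with hn_def
  set a := padicValNat 2 W.tamagawaProduct
  set b := padicValNat 2 Wd.tamagawaProduct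
  constructor
  · -- `2^a ≤ (n+1) 2^a = 2^b`
    have hle : 2 ^ a ≤ 2 ^ b := by
      calc 2 ^ a ≤ (n + 1) * 2 ^ a := Nat.le_mul_of_pos_left _ (Nat.succ_pos n)
        _ = 2 ^ b := h
    exact (Nat.pow_le_pow_iff_right Nat.one_lt_two).mp hle
  · -- `2^b = (n+1) 2^a ≤ 4 · 2^a = 2^(a+2)`
    have hle : 2 ^ b ≤ 2 ^ (a + 2) := by
      calc 2 ^ b = (n + 1) * 2 ^ a := h.symm
        _ ≤ 4 * 2 ^ a := Nat.mul_le_mul_right _ (by omega)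
        _ = 2 ^ (a + 2) := by ring
    exact (Nat.pow_le_pow_iff_right Nat.one_lt_two).mp hle

/-! ## §2 `Δ < 0`: the ramified prime is of transposition type -/

/-- **`Δ_W < 0` ⟹ `n_ℓ = 1`**: on the prime frame the ramified prime sees exactly one root of the `2`-division cubic (transposition type) —
the root-side form of `OneBit.padicValNat_two_tamagawaProduct_twin_eq_succ_of_discr_eq_neg_prime` (p767140).  UNCONDITIONAL.
[cite: Kramer1981, §2 Prop. 3] [cite: SilvermanAEC2009, VII.6] -/
theorem ncard_roots_eq_one_of_discr_eq_neg_prime_of_Δ_neg (hK : IsImaginaryQuadratic K) (hodd : Odd (NumberField.discr K))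
    (hH : SatisfiesHeegnerHypothesis (W.conductorNorm ℤ) K) {ℓ : ℕ} (hℓ : ℓ.Prime) (hd : NumberField.discr K = -(ℓ : ℤ)) (hΔ : W.Δ < 0)
    {Wd : WeierstrassCurve ℚ} [Wd.IsElliptic] (Cd : VariableChange ℚ) (hWd : Cd • W.quadraticTwist (NumberField.discr K : ℚ) = Wd) :
    {x : ZMod ℓ | 4 * x ^ 3 + ((integralModelInt W).b₂ : ZMod ℓ) * x ^ 2 +
        2 * ((integralModelInt W).b₄ : ZMod ℓ) * x + ((integralModelInt W).b₆ : ZMod ℓ) = 0}.ncard = 1 := by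
  have h := ncard_roots_add_one_mul_eq_of_discr_eq_neg_prime W hK hodd hH hℓ hd Cd hWd
  rw [padicValNat_two_tamagawaProduct_twin_eq_succ_of_discr_eq_neg_prime W hK hodd hH hℓ hd hΔ Cd hWd, pow_succ, mul_comm (2 ^ _) 2] at h
  have := Nat.eq_of_mul_eq_mul_right (Nat.two_pow_pos _) h
  omega

/-! ## §3 `Δ > 0`: the ramified prime is silent or of identity type -/

/-- **`0 < Δ_W` ⟹ `ord₂ C(Wd) = ord₂ C(W)` or `ord₂ C(Wd) = ord₂ C(W) + 2`** on the prime frame: the bit count is even (parity law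
`BudgetParity.even_padicValNat_add_of_Δ_pos`, p767705) and at most `2` (§1).  UNCONDITIONAL.  [cite: Kramer1981, §2 Prop. 3] -/
theorem padicValNat_twin_eq_or_eq_add_two_of_discr_eq_neg_prime_of_Δ_pos (hK : IsImaginaryQuadratic K)
    (hodd : Odd (NumberField.discr K)) (hH : SatisfiesHeegnerHypothesis (W.conductorNorm ℤ) K) {ℓ : ℕ} (hℓ : ℓ.Prime)
    (hd : NumberField.discr K = -(ℓ : ℤ)) (hΔ : 0 < W.Δ)
    {Wd : WeierstrassCurve ℚ} [Wd.IsElliptic] (Cd : VariableChange ℚ) (hWd : Cd • W.quadraticTwist (NumberField.discr K : ℚ) = Wd) :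
    padicValNat 2 Wd.tamagawaProduct = padicValNat 2 W.tamagawaProduct ∨
      padicValNat 2 Wd.tamagawaProduct = padicValNat 2 W.tamagawaProduct + 2 := by
  obtain ⟨h1, h2⟩ := padicValNat_le_and_le_add_two_of_discr_eq_neg_prime W hK hodd hH hℓ hd Cd hWd
  obtain ⟨k, hk⟩ := even_padicValNat_add_of_Δ_pos W hK hodd hH hΔ Cd hWd
  omega

/-- **`0 < Δ_W` ⟹ `n_ℓ = 0` or `n_ℓ = 3`**: on the prime frame the ramified prime sees no root (silent, `3`-cycle type) or all three
roots (identity type) of the `2`-division cubic.  UNCONDITIONAL.  [cite: Kramer1981, §2 Prop. 3] [cite: SilvermanAEC2009, VII.6] -/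
theorem ncard_roots_eq_zero_or_eq_three_of_discr_eq_neg_prime_of_Δ_pos (hK : IsImaginaryQuadratic K)
    (hodd : Odd (NumberField.discr K)) (hH : SatisfiesHeegnerHypothesis (W.conductorNorm ℤ) K) {ℓ : ℕ} (hℓ : ℓ.Prime)
    (hd : NumberField.discr K = -(ℓ : ℤ)) (hΔ : 0 < W.Δ)
    {Wd : WeierstrassCurve ℚ} [Wd.IsElliptic] (Cd : VariableChange ℚ) (hWd : Cd • W.quadraticTwist (NumberField.discr K : ℚ) = Wd) :
    {x : ZMod ℓ | 4 * x ^ 3 + ((integralModelInt W).b₂ : ZMod ℓ) * x ^ 2 +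
        2 * ((integralModelInt W).b₄ : ZMod ℓ) * x + ((integralModelInt W).b₆ : ZMod ℓ) = 0}.ncard = 0 ∨
    {x : ZMod ℓ | 4 * x ^ 3 + ((integralModelInt W).b₂ : ZMod ℓ) * x ^ 2 +
        2 * ((integralModelInt W).b₄ : ZMod ℓ) * x + ((integralModelInt W).b₆ : ZMod ℓ) = 0}.ncard = 3 := by
  have h := ncard_roots_add_one_mul_eq_of_discr_eq_neg_prime W hK hodd hH hℓ hd Cd hWd
  rcases padicValNat_twin_eq_or_eq_add_two_of_discr_eq_neg_prime_of_Δ_pos W hK hodd hH hℓ hd hΔ Cd hWd with h0 | h2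
  · left
    rw [h0] at h
    have := Nat.eq_of_mul_eq_mul_right (Nat.two_pow_pos _) (h.trans (one_mul _).symm)
    omega
  · right
    rw [h2, pow_add, mul_comm (2 ^ _) (2 ^ 2)] at h
    have := Nat.eq_of_mul_eq_mul_right (Nat.two_pow_pos _) h
    omega

/-- **Dictionary, silent side (any sign of `Δ`): `ord₂ C(Wd) = ord₂ C(W)` ⟺ the `2`-division cubic has NO root mod `ℓ`** — the clause
of the prime-frame reversed supplies S2″′ / S2⁼′ is exactly «the twist is silent» (on `0 < Δ_W`: ⟺ «`ℓ` is not of identity type»; on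
`Δ_W < 0` both sides are false by §2).  UNCONDITIONAL.
[cite: Kramer1981, §2 Prop. 3] [cite: SilvermanAEC2009, VII.6] -/
theorem padicValNat_twin_eq_iff_forall_ne_zero (hK : IsImaginaryQuadratic K)
    (hodd : Odd (NumberField.discr K)) (hH : SatisfiesHeegnerHypothesis (W.conductorNorm ℤ) K) {ℓ : ℕ} (hℓ : ℓ.Prime)
    (hd : NumberField.discr K = -(ℓ : ℤ))
    {Wd : WeierstrassCurve ℚ} [Wd.IsElliptic] (Cd : VariableChange ℚ) (hWd : Cd • W.quadraticTwist (NumberField.discr K : ℚ) = Wd) :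
    padicValNat 2 Wd.tamagawaProduct = padicValNat 2 W.tamagawaProduct ↔
      ∀ x : ZMod ℓ, 4 * x ^ 3 + ((integralModelInt W).b₂ : ZMod ℓ) * x ^ 2 +
        2 * ((integralModelInt W).b₄ : ZMod ℓ) * x + ((integralModelInt W).b₆ : ZMod ℓ) ≠ 0 := by
  haveI := Fact.mk hℓ
  have h := ncard_roots_add_one_mul_eq_of_discr_eq_neg_prime W hK hodd hH hℓ hd Cd hWd
  constructor
  · intro heq x hx
    rw [heq] at h
    have h0 : {x : ZMod ℓ | 4 * x ^ 3 + ((integralModelInt W).b₂ : ZMod ℓ) * x ^ 2 +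
        2 * ((integralModelInt W).b₄ : ZMod ℓ) * x + ((integralModelInt W).b₆ : ZMod ℓ) = 0}.ncard = 0 := by
      have := Nat.eq_of_mul_eq_mul_right (Nat.two_pow_pos _) (h.trans (one_mul _).symm)
      omega
    rw [Set.ncard_eq_zero (Set.toFinite _)] at h0
    exact (Set.eq_empty_iff_forall_notMem.mp h0) x hx
  · intro hno
    have hempty : {x : ZMod ℓ | 4 * x ^ 3 + ((integralModelInt W).b₂ : ZMod ℓ) * x ^ 2 +
        2 * ((integralModelInt W).b₄ : ZMod ℓ) * x + ((integralModelInt W).b₆ : ZMod ℓ) = 0} = ∅ :=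
      Set.eq_empty_iff_forall_notMem.mpr fun x hx ↦ hno x hx
    rw [hempty, Set.ncard_empty, zero_add, one_mul] at h
    exact (Nat.pow_right_injective le_rfl h).symm

/-- **Dictionary, identity side (`0 < Δ_W`): `ord₂ C(Wd) = ord₂ C(W) + 2` ⟺ the `2`-division cubic HAS a root mod `ℓ`** (then it has all
three: `n_ℓ = 3`).  UNCONDITIONAL.  [cite: Kramer1981, §2 Prop. 3] [cite: SilvermanAEC2009, VII.6] -/
theorem padicValNat_twin_eq_add_two_iff_exists_eq_zero_of_Δ_pos (hK : IsImaginaryQuadratic K)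
    (hodd : Odd (NumberField.discr K)) (hH : SatisfiesHeegnerHypothesis (W.conductorNorm ℤ) K) {ℓ : ℕ} (hℓ : ℓ.Prime)
    (hd : NumberField.discr K = -(ℓ : ℤ)) (hΔ : 0 < W.Δ)
    {Wd : WeierstrassCurve ℚ} [Wd.IsElliptic] (Cd : VariableChange ℚ) (hWd : Cd • W.quadraticTwist (NumberField.discr K : ℚ) = Wd) :
    padicValNat 2 Wd.tamagawaProduct = padicValNat 2 W.tamagawaProduct + 2 ↔
      ∃ x : ZMod ℓ, 4 * x ^ 3 + ((integralModelInt W).b₂ : ZMod ℓ) * x ^ 2 +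
        2 * ((integralModelInt W).b₄ : ZMod ℓ) * x + ((integralModelInt W).b₆ : ZMod ℓ) = 0 := by
  have hiff := padicValNat_twin_eq_iff_forall_ne_zero W hK hodd hH hℓ hd Cd hWd
  rcases padicValNat_twin_eq_or_eq_add_two_of_discr_eq_neg_prime_of_Δ_pos W hK hodd hH hℓ hd hΔ Cd hWd with h0 | h2
  · constructor
    · intro h; omega
    · rintro ⟨x, hx⟩
      exact absurd hx (hiff.mp h0 x)
  · constructor
    · intro _
      by_contra hne
      have := hiff.mpr fun x hx ↦ hne ⟨x, hx⟩
      omega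
    · intro _; exact h2

end Frame

end Summit.BirchSwinnertonDyer.BirchSwinnertonDyer.Theorems.GenusExact.TwinSwap.PrimeFrame

end
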